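import Literature.Combinatorics.Sahi2008.Symmetry
import Literature.Combinatorics.Sahi2008.Multilinear
import Literature.Combinatorics.Sahi2008.IndependentAtoms
import Literature.Probability.LatticeModels.SahiThirdOrderCorrelation
import Literature.Probability.LatticeModels.SahiFourthOrderCorrelation
import Literature.Probability.LatticeModels.SahiIndependentAtoms

/-!
# Disjoint-slot localisation of Sahi's `E_n` and the threshold family (equality locus of `E_5` on `{0,1}⁴`)

Cell `prim-sahi` (crux `stmt-CriticalPhenomena-4575`, `--supports`), identities found by the census seat
`prim-sahi-census` (gen 4, hand-off `HandoffIdentitiesG4.lean` / `IDENTITIES.md`, 2026-08-19) while closing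
the equality locus of the exhaustive `E_5` census on `{0,1}⁴`; typed and landed by the typer seat.  These are
OUR identities (consequences of the Lieb–Sahi recursion, `Literature.Combinatorics.Sahi2008.sahiE_cons`), not
cited facts; nothing here is conjectural.

* **(L-disj) disjoint-slot localisation**, every `n`, any weight, any functions
  (`sahiE_cons_of_annihilating`, `sahiE_cons_cons_of_annihilating`; census proofs): if `g_i · w = 0` for
  every slot `i` of `g` then `E_{n+2}(w, g) = −E(w)·E_{n+1}(g)` and
  `E_{n+3}(w, h, g) = −E(w)·E_{n+2}(h, g) − E(h·w)·E_{n+1}(g)`; event form at `n = 4`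
  (`sahiE4_of_disjoint`, `sahiE4_eq_zero_of_disjoint_of_indep_of_union_subset`).
* **absorbed free slot** (`sahiE_cons_eq_zero_of_indepMoments_of_absorb`): if `Y_0,…,Y_m` have
  multiplicative joint moments and `h` absorbs every product of all `Y`'s but one (`h·Π_{l≠i} Y_l = Π_{l≠i} Y_l`)
  then `E_{m+2}(h, Y) = 0` — every covariance of `IndependentAtoms.sahiE_eq_sum_cov_of_indepMoments`
  vanishes.
* **(T′) the threshold family**, every `m ≥ 2` (`sahiE_thrFamily_eq_zero`, the census's typed target, here
  PROVED): atoms `x_1,…,x_m` and `z` with multiplicative joint moments, `u` absorbing every atom, `h`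
  absorbing every `(m−1)`-fold product of atoms ⇒ `E_{m+2}(z·u, h, x_1,…,x_m) = 0`.  Proof: `z·u = z − w`,
  `w = z(1−u)` annihilates every atom; multilinearity; the `z`-term vanishes by the absorbed-free-slot lemma
  (for the independent family `(z, x)`), the `w`-term by (L-disj) and the same lemma for `x` plus
  `sahiE_eq_zero_of_indepMoments`.
-/

noncomputable section

namespace Summit.CriticalPhenomena.PercolationContinuityZ3.Theorems

namespace SahiIdentities

open Finset Function
open Literature.Combinatorics.Sahi2008

section Functions

variable {α : Type*} [Fintype α]

/-! ### (L-disj): an annihilating slot localises `E_n` (census seat prim-sahi-census, gen 4) -/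

/-- **(L-disj₀) an annihilating head slot.** If `g_i · w = 0` for all `i` then
`E_{n+2}(w, g_0,…,g_n) = −E_{n+1}(g)·E(w)` (only the split with `{w}` a singleton block survives).
(Proof: the census seat's, from the Lieb–Sahi recursion.) [cite: LiebSahi2021, Prop. 3.3] -/
theorem sahiE_cons_of_annihilating (μ : α → ℝ) (n : ℕ) (w : α → ℝ) (g : Fin (n + 1) → α → ℝ)
    (hg : ∀ i, g i * w = 0) :
    sahiE μ (n + 2) (Matrix.vecCons w g) = -(sahiE μ (n + 1) g * ex μ w) := by
  rw [sahiE_cons]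
  simp only [hg, sahiE_update_zero, sum_const_zero, zero_sub]

/-- **(L-disj) disjoint-slot localisation, every `n`.** If `g_i · w = 0` for all `i` and `h` is one further,
arbitrary function, then `E_{n+3}(w, h, g_0,…,g_n) = −E(w)·E_{n+2}(h, g) − E(h·w)·E_{n+1}(g)`; no
independence and no sign condition on `μ`. (Census seat's proof.) [cite: LiebSahi2021, Prop. 3.3] -/
theorem sahiE_cons_cons_of_annihilating (μ : α → ℝ) (n : ℕ) (w h : α → ℝ) (g : Fin (n + 1) → α → ℝ)
    (hg : ∀ i, g i * w = 0) :
    sahiE μ (n + 3) (Matrix.vecCons w (Matrix.vecCons h g)) =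
      -(ex μ w * sahiE μ (n + 2) (Matrix.vecCons h g)) - ex μ (h * w) * sahiE μ (n + 1) g := by
  rw [sahiE_cons, Fin.sum_univ_succ]
  have h0 : update (Matrix.vecCons h g) 0 (Matrix.vecCons h g 0 * w) = Matrix.vecCons (h * w) g := by
    funext i
    refine Fin.cases ?_ (fun j => ?_) i
    · rw [update_self, Matrix.cons_val_zero, Matrix.cons_val_zero]
    · rw [update_of_ne (Fin.succ_ne_zero j), Matrix.cons_val_succ, Matrix.cons_val_succ]
  have hg' : ∀ i, g i * (h * w) = 0 := fun i => by
    rw [mul_left_comm, hg i, mul_zero]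
  rw [h0, sahiE_cons_of_annihilating μ n (h * w) g hg']
  simp only [Matrix.cons_val_succ, hg, sahiE_update_zero, sum_const_zero, add_zero]
  ring

/-! ### Products over sub-families of a `cons` family (plumbing) -/

/-- `Π_{j ∈ T} (a :: G)_j = [0 ∈ T]·a · Π_{i : i+1 ∈ T} G_i` (plumbing). -/
theorem prod_finset_cons {M : Type*} [CommMonoid M] {k : ℕ} (a : M) (G : Fin k → M)
    (T : Finset (Fin (k + 1))) :
    ∏ j ∈ T, (Matrix.vecCons a G : Fin (k + 1) → M) j =
      (if (0 : Fin (k + 1)) ∈ T then a else 1) * ∏ i ∈ univ.filter (fun i : Fin k => i.succ ∈ T), G i := by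
  classical
  rw [← Fintype.prod_ite_mem T, Fin.prod_univ_succ, prod_filter]
  simp only [Matrix.cons_val_zero, Matrix.cons_val_succ]

/-- Expectations of a `cons` family, slotwise (plumbing). -/
theorem ex_vecCons_apply (μ : α → ℝ) {k : ℕ} (a : α → ℝ) (G : Fin k → α → ℝ) (j : Fin (k + 1)) :
    ex μ ((Matrix.vecCons a G : Fin (k + 1) → α → ℝ) j) =
      (Matrix.vecCons (ex μ a) (fun i => ex μ (G i)) : Fin (k + 1) → ℝ) j := by
  refine Fin.cases ?_ (fun i => ?_) j
  · simp only [Matrix.cons_val_zero]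
  · simp only [Matrix.cons_val_succ]

/-- **Moments off the head slot**: if `G` has multiplicative joint moments then so has `(a :: G)` off
slot `0` (the hypothesis shape of `IndependentAtoms.sahiE_eq_sum_cov_of_indepMoments` with `s = 0`). -/
theorem indepMoments_cons_off_zero (μ : α → ℝ) {k : ℕ} (a : α → ℝ) (G : Fin k → α → ℝ)
    (hG : ∀ T : Finset (Fin k), ex μ (∏ j ∈ T, G j) = ∏ j ∈ T, ex μ (G j)) :
    ∀ S : Finset (Fin (k + 1)), (0 : Fin (k + 1)) ∉ S →
      ex μ (∏ j ∈ S, (Matrix.vecCons a G : Fin (k + 1) → α → ℝ) j) =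
        ∏ j ∈ S, ex μ ((Matrix.vecCons a G : Fin (k + 1) → α → ℝ) j) := by
  intro S hS
  rw [prod_finset_cons, if_neg hS, one_mul, hG]
  rw [prod_congr rfl fun j _ => ex_vecCons_apply μ a G j, prod_finset_cons, if_neg hS, one_mul]

/-- **Adjoining an independent head**: if `x` has multiplicative joint moments and `z` is multiplicative
against every product of the `x`'s, then `(z :: x)` has multiplicative joint moments. -/
theorem indepMoments_cons (μ : α → ℝ) {k : ℕ} (z : α → ℝ) (x : Fin k → α → ℝ)
    (hx : ∀ T : Finset (Fin k), ex μ (∏ j ∈ T, x j) = ∏ j ∈ T, ex μ (x j))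
    (hz : ∀ T : Finset (Fin k), ex μ (z * ∏ j ∈ T, x j) = ex μ z * ∏ j ∈ T, ex μ (x j)) :
    ∀ T : Finset (Fin (k + 1)),
      ex μ (∏ j ∈ T, (Matrix.vecCons z x : Fin (k + 1) → α → ℝ) j) =
        ∏ j ∈ T, ex μ ((Matrix.vecCons z x : Fin (k + 1) → α → ℝ) j) := by
  intro T
  rw [prod_finset_cons, prod_congr rfl fun j _ => ex_vecCons_apply μ z x j, prod_finset_cons]
  by_cases h0 : (0 : Fin (k + 1)) ∈ T
  · rw [if_pos h0, if_pos h0, hz]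
  · rw [if_neg h0, if_neg h0, one_mul, one_mul, hx]

/-! ### An absorbed free slot against an independent family -/

/-- The product over all slots but `i+1` of a `cons` family (plumbing). -/
theorem prod_erase_succ_vecCons {M : Type*} [CommMonoid M] {k : ℕ} (a : M) (G : Fin k → M) (i : Fin k) :
    ∏ l ∈ univ.erase i.succ, (Matrix.vecCons a G : Fin (k + 1) → M) l = a * ∏ l ∈ univ.erase i, G l := by
  classical
  rw [prod_finset_cons, if_pos (mem_erase.2 ⟨(Fin.succ_ne_zero i).symm, mem_univ _⟩)]
  congr 1
  refine prod_congr ?_ fun _ _ => rfl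
  ext l
  simp only [mem_filter, mem_univ, true_and, mem_erase, ne_eq, and_true, Fin.succ_inj]

/-- **An absorbed free slot kills `E_n` of an independent family**: if `Y_0,…,Y_m` have multiplicative joint
moments and `h·Π_{l≠i} Y_l = Π_{l≠i} Y_l` for every `i`, then `E_{m+2}(h, Y_0,…,Y_m) = 0` (each covariance
`Cov(Y_i, h·Π_{l≠i} Y_l) = E(Π Y) − E(Y_i)E(Π_{l≠i} Y_l)` of the covariance form vanishes). -/
theorem sahiE_cons_eq_zero_of_indepMoments_of_absorb (μ : α → ℝ) (m : ℕ) (h : α → ℝ)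
    (Y : Fin (m + 1) → α → ℝ)
    (hY : ∀ T : Finset (Fin (m + 1)), ex μ (∏ j ∈ T, Y j) = ∏ j ∈ T, ex μ (Y j))
    (hh : ∀ i, h * ∏ l ∈ univ.erase i, Y l = ∏ l ∈ univ.erase i, Y l) :
    sahiE μ (m + 2) (Matrix.vecCons h Y) = 0 := by
  classical
  set F : Fin (m + 2) → α → ℝ := Matrix.vecCons h Y with hF
  rw [sahiE_eq_sum_cov_of_indepMoments μ m F 0 (indepMoments_cons_off_zero μ h Y hY)]
  have hfull : h * ∏ l, Y l = ∏ l, Y l := by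
    rw [← mul_prod_erase univ Y (mem_univ 0), mul_left_comm, hh 0]
  have hterm : ∀ j ∈ univ.erase (0 : Fin (m + 2)),
      ex μ (F j * ∏ l, update F j 1 l) - ex μ (F j) * ex μ (∏ l, update F j 1 l) = 0 := by
    intro j hj
    obtain ⟨i, rfl⟩ := Fin.exists_succ_eq.2 (ne_of_mem_erase hj)
    rw [mul_prod_update_one, prod_update_one_eq_prod_erase, hF, Fin.prod_univ_succ]
    simp only [Matrix.cons_val_zero, Matrix.cons_val_succ]
    rw [hfull, prod_erase_succ_vecCons, hh i, hY univ, hY (univ.erase i),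
      ← mul_prod_erase univ (fun l => ex μ (Y l)) (mem_univ i), sub_self]
  rw [sum_eq_zero hterm, mul_zero]

/-! ### (T′): the threshold family -/

/-- **(T′) the threshold family, every `m = n + 2 ≥ 2`** (the census's typed target; closes the 11 residual
identically-zero classes of the `E_5` census on `{0,1}⁴`): atoms `x_0,…,x_{n+1}` with multiplicative joint
moments, `z` multiplicative against every product of atoms, `u` absorbing every atom (`x_i·u = x_i`), `h`
absorbing every product of all atoms but one ⇒ `E_{n+4}(z·u, h, x_0,…,x_{n+1}) = 0`.  Proof: `z·u = z − w`
with `w = z·(1 − u)` annihilating every atom; by multilinearity `E(z·u,h,x) = E(z,h,x) − E(w,h,x)`; the first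
term is `E(h,z,x) = 0` (absorbed free slot against the independent family `(z,x)`), the second is
`−E(w)E(h,x) − E(hw)E(x) = 0` by (L-disj), the absorbed free slot against `x`, and `E_n(x) = 0` for an
independent family. -/
theorem sahiE_thrFamily_eq_zero (μ : α → ℝ) (n : ℕ) (x : Fin (n + 2) → α → ℝ) (z u h : α → ℝ)
    (hx : ∀ S : Finset (Fin (n + 2)), ex μ (∏ j ∈ S, x j) = ∏ j ∈ S, ex μ (x j))
    (hz : ∀ S : Finset (Fin (n + 2)), ex μ (z * ∏ j ∈ S, x j) = ex μ z * ∏ j ∈ S, ex μ (x j))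
    (hu : ∀ i, x i * u = x i)
    (hh : ∀ j, h * ∏ l ∈ univ.erase j, x l = ∏ l ∈ univ.erase j, x l) :
    sahiE μ (n + 4) (Matrix.vecCons (z * u) (Matrix.vecCons h x)) = 0 := by
  classical
  set w : α → ℝ := z * (1 - u) with hw
  set G : Fin (n + 3) → α → ℝ := Matrix.vecCons h x with hG
  -- `z·u = 1·z + (−1)·w`, multilinearity in slot `0`
  have hzu : z * u = (1 : ℝ) • z + (-1 : ℝ) • w := by
    rw [hw]
    funext a
    simp only [Pi.add_apply, Pi.smul_apply, Pi.mul_apply, Pi.sub_apply, Pi.one_apply, smul_eq_mul]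
    ring
  have hupd : ∀ v : α → ℝ,
      (Matrix.vecCons v G : Fin (n + 4) → α → ℝ) = update (Matrix.vecCons z G) 0 v := by
    intro v
    funext i
    refine Fin.cases ?_ (fun j => ?_) i
    · rw [update_self, Matrix.cons_val_zero]
    · rw [update_of_ne (Fin.succ_ne_zero j), Matrix.cons_val_succ, Matrix.cons_val_succ]
  have hlin : sahiE μ (n + 4) (Matrix.vecCons (z * u) G) =
      sahiE μ (n + 4) (Matrix.vecCons z G) - sahiE μ (n + 4) (Matrix.vecCons w G) := by
    rw [hupd (z * u), hzu, sahiE_update_lin, ← hupd z, ← hupd w]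
    ring
  -- `w` annihilates every atom
  have hxw : ∀ i, x i * w = 0 := fun i => by
    rw [hw]
    calc x i * (z * (1 - u)) = z * (x i - x i * u) := by ring
      _ = 0 := by rw [hu i, sub_self, mul_zero]
  -- `h` absorbs every product of all of `(z, x)` but one
  have hfull : h * ∏ l, x l = ∏ l, x l := by
    rw [← mul_prod_erase univ x (mem_univ 0), mul_left_comm, hh 0]
  have hhY : ∀ i : Fin (n + 3), h * ∏ l ∈ univ.erase i, (Matrix.vecCons z x : Fin (n + 3) → α → ℝ) l =
      ∏ l ∈ univ.erase i, (Matrix.vecCons z x : Fin (n + 3) → α → ℝ) l := by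
    intro i
    refine Fin.cases ?_ (fun i' => ?_) i
    · -- all atoms, no `z`
      have e : ∏ l ∈ univ.erase (0 : Fin (n + 3)), (Matrix.vecCons z x : Fin (n + 3) → α → ℝ) l =
          ∏ l, x l := by
        rw [prod_finset_cons, if_neg (fun h => (mem_erase.1 h).1 rfl), one_mul]
        refine prod_congr ?_ fun _ _ => rfl
        ext l
        simp only [mem_filter, mem_univ, true_and, mem_erase, ne_eq, Fin.succ_ne_zero, not_false_eq_true]
      rw [e, hfull]
    · rw [prod_erase_succ_vecCons, mul_left_comm, hh i']
  -- the `z`-term vanishes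
  have hz0 : sahiE μ (n + 4) (Matrix.vecCons z G) = 0 := by
    rw [hG]
    rw [show sahiE μ (n + 4) (Matrix.vecCons z (Matrix.vecCons h x)) =
        sahiE μ (n + 4) (Matrix.vecCons h (Matrix.vecCons z x)) from sahiE_cons_cons_comm μ (n + 1) z h x]
    exact sahiE_cons_eq_zero_of_indepMoments_of_absorb μ (n + 2) h (Matrix.vecCons z x)
      (indepMoments_cons μ z x hx hz) hhY
  -- the `w`-term vanishes
  have hw0 : sahiE μ (n + 4) (Matrix.vecCons w G) = 0 := by
    rw [hG, sahiE_cons_cons_of_annihilating μ (n + 1) w h x hxw,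
      sahiE_cons_eq_zero_of_indepMoments_of_absorb μ (n + 1) h x hx hh,
      sahiE_eq_zero_of_indepMoments μ n x hx]
    ring
  rw [hlin, hz0, hw0, sub_self]

end Functions

/-! ### (L-disj) at `n = 4`, event form -/

section Events

open MeasureTheory
open Literature.Probability.LatticeModels

variable {Ω : Type*} [MeasurableSpace Ω] (μ : Measure Ω)

/-- **(L-disj) at `n = 4`, event form.** If `W` is disjoint from `X₁` and from `X₂` then
`E₄(X₁, X₂, W, H) = −μ(W)·E₃(X₁, X₂, H) − μ(W ∩ H)·(μ(X₁ ∩ X₂) − μ(X₁)μ(X₂))` (any measure; census seat's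
proof by `ring` on the closed forms). [cite: LiebSahi2021, Def. 3.1 (display of E₄)] -/
theorem sahiE4_of_disjoint (X₁ X₂ W H : Set Ω) (h₁ : X₁ ∩ W = ∅) (h₂ : X₂ ∩ W = ∅) :
    sahiE4 μ X₁ X₂ W H =
      -(μ.real W * sahiE3 μ X₁ X₂ H) - μ.real (W ∩ H) * (μ.real (X₁ ∩ X₂) - μ.real X₁ * μ.real X₂) := by
  have e3 : X₁ ∩ X₂ ∩ W = ∅ := by rw [Set.inter_assoc, h₂, Set.inter_empty]
  have e1 : X₁ ∩ X₂ ∩ W ∩ H = ∅ := by rw [e3, Set.empty_inter]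
  have e4 : X₁ ∩ W ∩ H = ∅ := by rw [h₁, Set.empty_inter]
  have e5 : X₂ ∩ W ∩ H = ∅ := by rw [h₂, Set.empty_inter]
  rw [sahiE4_def, sahiE3_def, e1, e5, e4, e3, h₁, h₂, measureReal_empty]
  ring

/-- **The `R8`-type zeros of the `E_4` census** (census seat): `X₁, X₂` independent, `W` disjoint from
both, `H ⊇ X₁ ∪ X₂` ⇒ `E₄(X₁, X₂, W, H) = 0`. [cite: LiebSahi2021, Def. 3.1 (display of E₄)] -/
theorem sahiE4_eq_zero_of_disjoint_of_indep_of_union_subset (X₁ X₂ W H : Set Ω)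
    (h₁ : X₁ ∩ W = ∅) (h₂ : X₂ ∩ W = ∅)
    (hXY : μ.real (X₁ ∩ X₂) = μ.real X₁ * μ.real X₂) (hH : X₁ ∪ X₂ ⊆ H) :
    sahiE4 μ X₁ X₂ W H = 0 := by
  rw [sahiE4_of_disjoint μ X₁ X₂ W H h₁ h₂, sahiE3_eq_zero_of_indep_of_union_subset μ hXY hH, hXY]
  ring

end Events

end SahiIdentities

end Summit.CriticalPhenomena.PercolationContinuityZ3.Theorems
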